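import Literature.Analysis.FluidPDE.ConvexIntegration2DStep
import Mathlib.MeasureTheory.Constructions.BorelSpace.Metrizable
import Mathlib.MeasureTheory.Integral.DominatedConvergence
import HarnessLib

/-!
# Convex integration in 2-D: the iteration (CDK 2015, §4.1, constructive form)

Topic `Analysis/FluidPDE`. Support file (layer 5a of 5) for the proof of
`ConvexIntegrationLemma2DBall` (Chiodaroli–De Lellis–Kreml 2015, Lemma 3.7 on a ball). In place
of CDK's Baire-category argument (points of continuity of `I_N : X → L²`) we run the perturbation
step explicitly:

* three lemmas of elementary analysis: `tendsto_zero_of_sq_recursion`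
  (`J_{k+1} ≤ J_k + η_k - βJ_k²`, `∑η_k < ∞` ⇒ `J_k → 0`), `exists_forall_sub_lt_of_monotone`,
  `ae_exists_tendsto_of_summable_integral` (a.e. convergence from summable `L¹` increments);
* `IterData`: the fixed data of a run (`C`, base state `qt`, bounded open `Ω ≠ ∅`, start
  `p₀ ∈ X₀`, an observable `g ∈ C¹_c` on a component `cobs`, tolerance `θ`); tolerances
  `ε_k = θ 2^{-(k+1)}`;
* `IterData.seqAux/state/incr`: the iteration `p_{k+1} = p_k + w_k`, `w_k` given by `step` with
  the family "all components of `p_0, …, p_k` and `g`" and tolerance `ε_k` (history recursion,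
  `state_memX0`, `incr_orth_state`, `incr_orth_obs`, `incr_gain`);
The estimates along the iteration (`L²`-Cauchy, `J_k → 0`) are in
`ConvexIntegration2DIterationEstimates.lean`, the subsequence, its a.e. limit and the limit's
properties in `ConvexIntegration2DLimit.lean`.

## References

* E. Chiodaroli, C. De Lellis, O. Kreml, *Global ill-posedness of the isentropic system of gas
  dynamics*, Comm. Pure Appl. Math. 68 (2015) 1157–1190, §4.1.
-/

noncomputable section

open MeasureTheory Set Metric Filter Function
open scoped ContDiff Topology NNReal

namespace Literature.Analysis.FluidPDE.ConvexIntegration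


/-! ### Three lemmas of elementary analysis -/

/-- A non-negative sequence with `J_{k+1} ≤ J_k + η_k - β J_k²`, `∑ η_k < ∞`, `β > 0`, tends to
`0`. [folklore] -/
theorem tendsto_zero_of_sq_recursion {J η : ℕ → ℝ} {β : ℝ} (hβ : 0 < β) (hJ0 : ∀ k, 0 ≤ J k)
    (hη0 : ∀ k, 0 ≤ η k) (hη : Summable η) (hrec : ∀ k, J (k + 1) ≤ J k + η k - β * J k ^ 2) :
    Tendsto J atTop (𝓝 0) := by
  -- tails of `η`
  set T : ℕ → ℝ := fun n => ∑' i, η (i + n)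
  have hTs : ∀ n, Summable fun i => η (i + n) := fun n => (summable_nat_add_iff n).mpr hη
  have hT0 : Tendsto T atTop (𝓝 0) := tendsto_sum_nat_add η
  have hTnonneg : ∀ n, 0 ≤ T n := fun n => tsum_nonneg fun i => hη0 _
  have hpartial : ∀ n m, ∑ i ∈ Finset.range m, η (i + n) ≤ T n := fun n m =>
    (hTs n).sum_le_tsum _ (fun i _ => hη0 _)
  -- almost monotonicity, with the quadratic term kept when `J ≥ γ`
  have h1 : ∀ n m, J (n + m) ≤ J n + ∑ i ∈ Finset.range m, η (i + n) := by
    intro n m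
    induction m with
    | zero => simp
    | succ m ih =>
      rw [Finset.sum_range_succ, ← add_assoc]
      have := hrec (n + m)
      have : β * J (n + m) ^ 2 ≥ 0 := by positivity
      rw [add_comm m n]
      linarith
  -- infinitely often small
  have h2 : ∀ γ : ℝ, 0 < γ → ∀ n, ∃ k, n ≤ k ∧ J k < γ := by
    intro γ hγ n
    by_contra hcon
    push Not at hcon
    have hdec : ∀ m, J (n + m) ≤ J n + ∑ i ∈ Finset.range m, η (i + n) - m * (β * γ ^ 2) := by
      intro m
      induction m with
      | zero => simp
      | succ m ih =>
        have hk := hcon (n + m) (Nat.le_add_right n m)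
        have hr := hrec (n + m)
        have hsq : β * γ ^ 2 ≤ β * J (n + m) ^ 2 := by gcongr
        rw [Finset.sum_range_succ, ← add_assoc, add_comm m n]
        push_cast
        linarith
    obtain ⟨m, hm⟩ := exists_nat_gt ((J n + T n) / (β * γ ^ 2))
    have hpos : 0 < β * γ ^ 2 := by positivity
    have h' : J n + T n < m * (β * γ ^ 2) := (div_lt_iff₀ hpos).mp hm
    have := hdec m
    linarith [hJ0 (n + m), hpartial n m]
  -- conclusion
  rw [Metric.tendsto_atTop]
  intro γ hγ
  obtain ⟨n₀, hn₀⟩ := (Metric.tendsto_atTop.mp hT0) (γ / 2) (by linarith)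
  obtain ⟨k₀, hk₀, hJk₀⟩ := h2 (γ / 2) (by linarith) n₀
  refine ⟨k₀, fun k hk => ?_⟩
  rw [Real.dist_eq, sub_zero, abs_of_nonneg (hJ0 k)]
  obtain ⟨m, rfl⟩ := Nat.exists_eq_add_of_le hk
  have hTk : T k₀ < γ / 2 := by
    have := hn₀ k₀ hk₀
    rwa [Real.dist_eq, sub_zero, abs_of_nonneg (hTnonneg _)] at this
  calc J (k₀ + m) ≤ J k₀ + ∑ i ∈ Finset.range m, η (i + k₀) := h1 k₀ m
    _ ≤ J k₀ + T k₀ := by linarith [hpartial k₀ m]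
    _ < γ / 2 + γ / 2 := add_lt_add hJk₀ hTk
    _ = γ := by ring

/-- A monotone bounded real sequence has Cauchy increments. [folklore] -/
theorem exists_forall_sub_lt_of_monotone {F : ℕ → ℝ} (hF : Monotone F) {B : ℝ}
    (hB : ∀ k, F k ≤ B) {η : ℝ} (hη : 0 < η) :
    ∃ M : ℕ, ∀ n m, M ≤ n → n ≤ m → F m - F n < η := by
  have hbdd : BddAbove (range F) := ⟨B, by rintro _ ⟨k, rfl⟩; exact hB k⟩
  have hconv := tendsto_atTop_ciSup hF hbdd
  set L := ⨆ k, F k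
  obtain ⟨M, hM⟩ := (Metric.tendsto_atTop.mp hconv) η hη
  refine ⟨M, fun n m hn hnm => ?_⟩
  have h1 : F m ≤ L := le_ciSup hbdd m
  have h2 := hM n hn
  rw [Real.dist_eq, abs_lt] at h2
  linarith

/-- **Almost everywhere convergence from summable `L¹` increments** (the Riesz–Fischer
subsequence principle): if `∑ᵢ ∫ |G_{i+1} - G_i| < ∞` then `G_i(z)` converges for a.e. `z`.
[folklore] -/
theorem ae_exists_tendsto_of_summable_integral {G : ℕ → ST → ℝ} (hG : ∀ i, Continuous (G i))
    (hint : ∀ i, Integrable (fun z => G (i + 1) z - G i z)) {b : ℕ → ℝ} (hb : Summable b)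
    (hle : ∀ i, ∫ z, |G (i + 1) z - G i z| ≤ b i) :
    ∀ᵐ z, ∃ l : ℝ, Tendsto (fun i => G i z) atTop (𝓝 l) := by
  have hb0 : ∀ i, 0 ≤ b i := fun i => le_trans (integral_nonneg fun z => abs_nonneg _) (hle i)
  have hmeas : ∀ i, AEMeasurable (fun z => ‖G (i + 1) z - G i z‖ₑ) volume := fun i =>
    (((hG (i + 1)).sub (hG i)).measurable.enorm).aemeasurable
  have h1 : ∫⁻ z, ∑' i, ‖G (i + 1) z - G i z‖ₑ = ∑' i, ∫⁻ z, ‖G (i + 1) z - G i z‖ₑ :=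
    lintegral_tsum hmeas
  have h2 : ∀ i, ∫⁻ z, ‖G (i + 1) z - G i z‖ₑ ≤ ENNReal.ofReal (b i) := by
    intro i
    rw [← ofReal_integral_norm_eq_lintegral_enorm (hint i)]
    exact ENNReal.ofReal_le_ofReal (by simpa [Real.norm_eq_abs] using hle i)
  have h3 : ∫⁻ z, ∑' i, ‖G (i + 1) z - G i z‖ₑ < ⊤ := by
    rw [h1]
    calc ∑' i, ∫⁻ z, ‖G (i + 1) z - G i z‖ₑ ≤ ∑' i, ENNReal.ofReal (b i) := ENNReal.tsum_le_tsum h2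
      _ = ENNReal.ofReal (∑' i, b i) := (ENNReal.ofReal_tsum_of_nonneg hb0 hb).symm
      _ < ⊤ := ENNReal.ofReal_lt_top
  have hmeas' : Measurable fun z => ∑' i, ‖G (i + 1) z - G i z‖ₑ := by
    simp_rw [ENNReal.tsum_eq_iSup_sum]
    exact .iSup fun s => s.measurable_fun_sum fun i _ => ((hG (i + 1)).sub (hG i)).measurable.enorm
  have h4 : ∀ᵐ z, ∑' i, ‖G (i + 1) z - G i z‖ₑ < ⊤ :=
    ae_lt_top hmeas' h3.ne
  filter_upwards [h4] with z hz
  have hsum : Summable fun i => G (i + 1) z - G i z :=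
    .of_nnnorm <| ENNReal.tsum_coe_ne_top_iff_summable.mp hz.ne
  have hx_sum := hsum.hasSum.tendsto_sum_nat
  rw [funext fun n => Finset.sum_range_sub (fun m => G m z) n] at hx_sum
  exact ⟨∑' i, (G (i + 1) z - G i z) + G 0 z, by simpa using hx_sum.add_const (G 0 z)⟩


/-! ### The data of one run of the iteration -/

/-- The fixed data of one run of the convex-integration iteration: the constant `C`, the base
state `qt = (ṽ, ũ)`, the bounded open set `Ω`, the starting point `p₀ ∈ X₀`, an observable
amplitude `g ∈ C¹_c` acting on the component `cobs`, and the tolerance `θ > 0`.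
[cite: ChiodaroliDeLellisKreml2015, §4.1] -/
structure IterData where
  /-- the constant `C` (`|v|² = C` in the end) -/
  C : ℝ
  /-- the base state `(ṽ₁, ṽ₂, ũ₁₁, ũ₁₂)` -/
  qt : State
  /-- the domain -/
  Ω : Set ST
  /-- the starting perturbation -/
  p₀ : Fin 4 → ST → ℝ
  /-- the observable amplitude -/
  g : ST → ℝ
  /-- the observed component -/
  cobs : Fin 4
  /-- the tolerance -/
  θ : ℝ
  hC : 0 < C
  hqt : InU C qt
  hΩo : IsOpen Ω
  hΩb : Bornology.IsBounded Ω
  hΩne : Ω.Nonempty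
  hp₀ : MemX0 C qt Ω p₀
  hg : ContDiff ℝ 1 g
  hgc : HasCompactSupport g
  hθ : 0 < θ

namespace IterData

variable (d : IterData)

/-- The tolerance at stage `k`: `ε_k = θ 2^{-(k+1)}` (so `∑ ε_k = θ`). [folklore] -/
def eps (k : ℕ) : ℝ := d.θ / 2 ^ (k + 1)

/-- The tolerances are positive. [folklore] -/
theorem eps_pos (k : ℕ) : 0 < d.eps k := by unfold eps; have := d.hθ; positivity

/-- The tolerances are non-negative. [folklore] -/
theorem eps_nonneg (k : ℕ) : 0 ≤ d.eps k := (d.eps_pos k).le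

/-- The tolerances form a geometric sequence. [folklore] -/
theorem eps_eq (k : ℕ) : d.eps k = d.θ / 2 * (1 / 2) ^ k := by
  rw [eps, one_div, inv_pow, pow_succ]; ring

/-- The tolerances are summable. [folklore] -/
theorem summable_eps : Summable d.eps := by
  have : d.eps = fun k => d.θ / 2 * (1 / 2) ^ k := funext d.eps_eq
  rw [this]
  exact (summable_geometric_of_lt_one (by norm_num) (by norm_num)).mul_left _

/-- `∑ ε_k = θ`. [folklore] -/
theorem tsum_eps : ∑' k, d.eps k = d.θ := by
  have : d.eps = fun k => d.θ / 2 * (1 / 2) ^ k := funext d.eps_eq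
  rw [this, tsum_mul_left, tsum_geometric_of_lt_one (by norm_num) (by norm_num)]
  ring

/-- Partial sums of the tolerances are at most `θ`. [folklore] -/
theorem sum_eps_le (s : Finset ℕ) : ∑ k ∈ s, d.eps k ≤ d.θ := by
  rw [← d.tsum_eps]; exact d.summable_eps.sum_le_tsum s fun k _ => d.eps_nonneg k

/-- A *history* of length `k + 1` is admissible if all its entries lie in `X₀`. [folklore] -/
def HistOK (k : ℕ) (H : Fin (k + 1) → Fin 4 → ST → ℝ) : Prop := ∀ j, MemX0 d.C d.qt d.Ω (H j)

/-- The family of amplitudes the next increment must be nearly orthogonal to: all components of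
all previous states, and the observable. [folklore] -/
def family {k : ℕ} (H : Fin (k + 1) → Fin 4 → ST → ℝ) : (Fin (k + 1) × Fin 4) ⊕ Unit → ST → ℝ :=
  Sum.elim (fun ji => H ji.1 ji.2) (fun _ => d.g)

/-- The amplitudes of the family are `C¹`. [folklore] -/
theorem family_contDiff {k : ℕ} {H : Fin (k + 1) → Fin 4 → ST → ℝ} (hH : d.HistOK k H) :
    ∀ j, ContDiff ℝ 1 (d.family H j)
  | Sum.inl ji => ((hH ji.1).smooth ji.2).of_le one_le_infty
  | Sum.inr _ => d.hg

/-- The amplitudes of the family are compactly supported. [folklore] -/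
theorem family_hasCompactSupport {k : ℕ} {H : Fin (k + 1) → Fin 4 → ST → ℝ} (hH : d.HistOK k H) :
    ∀ j, HasCompactSupport (d.family H j)
  | Sum.inl ji => (hH ji.1).hasCompactSupport ji.2
  | Sum.inr _ => d.hgc

/-- The specification of the increment at stage `k` (an instance of `step`). [folklore] -/
theorem step_spec (k : ℕ) (H : {H : Fin (k + 1) → Fin 4 → ST → ℝ // d.HistOK k H}) :
    ∃ w : Fin 4 → ST → ℝ,
      (∀ c, ContDiff ℝ ∞ (w c)) ∧ (∀ c, HasCompactSupport (w c)) ∧ SolvesLinear w ∧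
      MemX0 d.C d.qt d.Ω (fun c z => H.1 (Fin.last k) c z + w c z) ∧
      (∀ j c, |∫ z, w c z * d.family H.1 j z| ≤ d.eps k) ∧ (∀ c, ∫ z, w c z = 0) ∧
      stepGain d.C d.Ω * defect d.C d.qt d.Ω (H.1 (Fin.last k)) ^ 2 - d.eps k
        ≤ ∫ z, (w 0 z ^ 2 + w 1 z ^ 2) :=
  step d.hC d.hqt d.hΩo d.hΩb (H.2 (Fin.last k)) (d.family H.1) (d.family_contDiff H.2)
    (d.family_hasCompactSupport H.2) (d.eps_pos k)

/-- **The iteration** (history form): the admissible history `(p₀, …, p_k)` of states.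
[cite: ChiodaroliDeLellisKreml2015, §4.1] -/
def seqAux : (k : ℕ) → {H : Fin (k + 1) → Fin 4 → ST → ℝ // d.HistOK k H}
  | 0 => ⟨fun _ => d.p₀, fun _ => d.hp₀⟩
  | k + 1 =>
    ⟨Fin.snoc (seqAux k).1 (fun c z => (seqAux k).1 (Fin.last k) c z
        + Classical.choose (d.step_spec k (seqAux k)) c z), by
      intro j
      refine Fin.lastCases ?_ (fun i => ?_) j
      · rw [Fin.snoc_last]
        exact (Classical.choose_spec (d.step_spec k (seqAux k))).2.2.2.1
      · rw [Fin.snoc_castSucc]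
        exact (seqAux k).2 i⟩

/-- The `k`-th state `p_k` of the iteration. [folklore] -/
def state (k : ℕ) : Fin 4 → ST → ℝ := (d.seqAux k).1 (Fin.last k)

/-- The `k`-th increment `w_k = p_{k+1} - p_k` of the iteration. [folklore] -/
def incr (k : ℕ) : Fin 4 → ST → ℝ := Classical.choose (d.step_spec k (d.seqAux k))

/-- `p_0 = p₀`. [folklore] -/
theorem state_zero : d.state 0 = d.p₀ := rfl

/-- `p_{k+1} = p_k + w_k`. [folklore] -/
theorem state_succ (k : ℕ) : d.state (k + 1) = fun c z => d.state k c z + d.incr k c z := by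
  show (d.seqAux (k + 1)).1 (Fin.last (k + 1)) = _
  simp only [seqAux, Fin.snoc_last]
  rfl

/-- `p_{k+1} = p_k + w_k`, pointwise. [folklore] -/
theorem state_succ_apply (k : ℕ) (c : Fin 4) (z : ST) :
    d.state (k + 1) c z = d.state k c z + d.incr k c z := by
  rw [state_succ]

/-- The history at stage `k + 1` extends the history at stage `k`. [folklore] -/
theorem seqAux_castSucc (k : ℕ) (j : Fin (k + 1)) :
    (d.seqAux (k + 1)).1 (Fin.castSucc j) = (d.seqAux k).1 j := by
  simp only [seqAux, Fin.snoc_castSucc]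

/-- The history consists of the states. [folklore] -/
theorem seqAux_eq_state (k : ℕ) (j : Fin (k + 1)) : (d.seqAux k).1 j = d.state j := by
  induction k with
  | zero =>
    have : j = 0 := Fin.eq_zero j
    subst this; rfl
  | succ k ih =>
    refine Fin.lastCases ?_ (fun i => ?_) j
    · rfl
    · rw [seqAux_castSucc, ih i]; rfl

/-- Every state lies in `X₀`. [folklore] -/
theorem state_memX0 (k : ℕ) : MemX0 d.C d.qt d.Ω (d.state k) := (d.seqAux k).2 (Fin.last k)

/-- The increments are smooth. [folklore] -/
theorem incr_smooth (k : ℕ) (c : Fin 4) : ContDiff ℝ ∞ (d.incr k c) :=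
  (Classical.choose_spec (d.step_spec k (d.seqAux k))).1 c

/-- The increments are compactly supported. [folklore] -/
theorem incr_hasCompactSupport (k : ℕ) (c : Fin 4) : HasCompactSupport (d.incr k c) :=
  (Classical.choose_spec (d.step_spec k (d.seqAux k))).2.1 c

/-- The increment at stage `k` is nearly orthogonal to all components of all states
`p_0, …, p_k`. [folklore] -/
theorem incr_orth_state {k j : ℕ} (hj : j ≤ k) (c c' : Fin 4) :
    |∫ z, d.incr k c z * d.state j c' z| ≤ d.eps k := by
  have h : |∫ z, d.incr k c z * d.family (d.seqAux k).1 (Sum.inl (⟨j, Nat.lt_succ_of_le hj⟩, c')) z|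
      ≤ d.eps k :=
    (Classical.choose_spec (d.step_spec k (d.seqAux k))).2.2.2.2.1 (Sum.inl (⟨j, Nat.lt_succ_of_le hj⟩, c')) c
  simp only [family, Sum.elim_inl] at h
  rw [seqAux_eq_state] at h
  exact h

/-- The increment at stage `k` is nearly orthogonal to the observable. [folklore] -/
theorem incr_orth_obs (k : ℕ) (c : Fin 4) : |∫ z, d.incr k c z * d.g z| ≤ d.eps k := by
  have h : |∫ z, d.incr k c z * d.family (d.seqAux k).1 (Sum.inr ()) z| ≤ d.eps k :=
    (Classical.choose_spec (d.step_spec k (d.seqAux k))).2.2.2.2.1 (Sum.inr ()) c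
  simpa [family] using h

/-- The increments have mean zero. [folklore] -/
theorem integral_incr (k : ℕ) (c : Fin 4) : ∫ z, d.incr k c z = 0 :=
  (Classical.choose_spec (d.step_spec k (d.seqAux k))).2.2.2.2.2.1 c

/-- The energy gain of the increment at stage `k`. [folklore] -/
theorem incr_gain (k : ℕ) :
    stepGain d.C d.Ω * defect d.C d.qt d.Ω (d.state k) ^ 2 - d.eps k
      ≤ ∫ z, (d.incr k 0 z ^ 2 + d.incr k 1 z ^ 2) :=
  (Classical.choose_spec (d.step_spec k (d.seqAux k))).2.2.2.2.2.2

end IterData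

end Literature.Analysis.FluidPDE.ConvexIntegration
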